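import Summits.Parity.GeneralizedHardyLittlewood.Theorems.PrimeLevelFamEdgeIdeaDeltasSplitPrimesDischarge
import Literature.NumberTheory.LFunctions.MertensTail

/-!
# Route `PrimeLevelFamEdge` — TYPED IDEA DELTAS, deck 9c: consequence (i) `SplitLogMassSmall` from
# Tao–Teräväinen Prop. 3.5 ALONE (via the (R1) discharge + Mertens I) — Heath-Brown 1983 Lemma 3 is no
# longer load-bearing (cell ls-idea, annex A-I8-5; KERNEL glue modulo ONE named fact)

Deck 9b proved `splitLogMassSmall_of_heathBrown : heathBrown1983_lemma3 → ∀ ε > 0, ∃ D₀,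
SplitLogMassSmall ε D₀` from a named fact that the tree holds only second-hand (HB83 Lemma 3 as quoted
by Tao–Teräväinen (3.20); acq-00505 cite-only). This file removes that dependency: the SAME conclusion
follows from `taoTeravainen2022_proposition35` (TT22 Prop. 3.5, held first-hand) through deck 9b's
`splitHarmonicMassConfined_of_taoTeravainen` and the tree's PROVED Mertens bound
`MertensBound.sum_log_div_prime_bounds` (`Σ_{p ≤ t} log p/p ≤ log t + 2`):

  `Σ_{p ≤ D, χ(p)=1} log p/p ≤ Σ_{p < D^t} log p/p + log D · Σ_{D^t ≤ p ≤ D, χ(p)=1} 1/p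
                      ≤ (t log D + 2) + log D · K(t,1) (log D)^{−t/(1+4t)} ≤ ε log D`

for `t = min(ε/3, 1/2)` and `log D` beyond an explicit threshold. This is exactly TT's remark after
Prop. 3.5 («it is not difficult to recover (3.21) (and hence (3.20)) from the above proposition … using
Mertens' theorem»), in the weak form the consumer needs. CONDITIONAL on the one named fact; nothing
asserts that an exceptional character exists: «no exceptional-zero theorem (no Landau–Siegel /
Siegel-zero exclusion, no Theorem 1–2 of arXiv:2211.02515, no repaired Margin232) is proved by ideation;
typed ≠ proved».
-/

noncomputable section

namespace Summit.Parity.GeneralizedHardyLittlewood.Theorems.PrimeLevelFamEdgeIdeaDeltas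

open Literature.NumberTheory.LFunctions

/-- Mertens I in the form used here: the logarithmic mass of ALL primes `< ⌈y⌉` is `≤ log y + 2`
(`y ≥ 1`; tree `MertensBound.sum_log_div_prime_bounds` over `primesLE ⌊y⌋`, and `p < ⌈y⌉ ⇒ p ≤ ⌊y⌋`).
[cite: HardyWright2008, Thm 425 (§22.6)] -/
theorem sum_log_div_lt_ceil_le {D : ℕ} (χ : DirichletCharacter ℂ D) {y : ℝ} (hy : 1 ≤ y) :
    (∑ p ∈ ((Finset.Icc 1 D).filter (fun p : ℕ => p.Prime ∧ χ ((p : ℕ) : ZMod D) = 1)).filter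
        (fun p : ℕ => p < ⌈y⌉₊), Real.log (p : ℝ) / (p : ℝ)) ≤ Real.log y + 2 := by
  refine le_trans ?_ (MertensBound.sum_log_div_prime_bounds hy).2
  apply Finset.sum_le_sum_of_subset_of_nonneg
  · intro p hp
    simp only [Finset.mem_filter, Finset.mem_Icc] at hp
    obtain ⟨⟨_, hpr, _⟩, hlt⟩ := hp
    rw [Nat.mem_primesLE]
    refine ⟨?_, hpr⟩
    have h1 : ⌈y⌉₊ ≤ ⌊y⌋₊ + 1 := Nat.ceil_le_floor_add_one y
    omega
  · intro p hp _
    rw [Nat.mem_primesLE] at hp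
    have hp2 : (2 : ℝ) ≤ p := by exact_mod_cast hp.2.two_le
    exact div_nonneg (Real.log_nonneg (by linarith)) (by linarith)

/-- **Consequence (i) from Prop. 3.5 alone (annex A-I8-5; supersedes the Heath-Brown route of deck 9b
as the dependency of record):** modulo the named fact `taoTeravainen2022_proposition35`, for every
`ε > 0` there is `D₀` with `SplitLogMassSmall ε D₀` — in the (A)_{3/2}-world
`Σ_{p ≤ D, χ(p)=1} log p/p ≤ ε log D` for all `D ≥ D₀`. Proof: split at `D^t`, `t = min(ε/3, 1/2)`;
below, Mertens I (`≤ t log D + 2`); above, `log p ≤ log D` times the (R1) bound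
`SplitHarmonicMassConfined t 1 K` of deck 9b (`≤ K (log D)^{−t/(1+4t)}`); choose `log D` so large that
`2 ≤ (ε/3) log D` and `K (log D)^{−t/(1+4t)} ≤ ε/3`. CONDITIONAL on the named fact; nothing asserts that
an exceptional character exists. [cite: TaoTeravainen2022SiegelZero, Proposition 3.5 and the remark following it ((3.20)–(3.21) «using Mertens' theorem»)] [cite: HardyWright2008, Thm 425] -/
theorem splitLogMassSmall_of_taoTeravainen (hTT : taoTeravainen2022_proposition35) {ε : ℝ}
    (hε : 0 < ε) : ∃ D₀ : ℕ, SplitLogMassSmall ε D₀ := by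
  obtain ⟨t, htdef⟩ : ∃ t : ℝ, t = min (ε / 3) (1 / 2) := ⟨_, rfl⟩
  have ht0 : 0 < t := by rw [htdef]; exact lt_min (by positivity) (by norm_num)
  have ht1 : t < 1 := by rw [htdef]; exact lt_of_le_of_lt (min_le_right _ _) (by norm_num)
  have htε : t ≤ ε / 3 := by rw [htdef]; exact min_le_left _ _
  obtain ⟨K, hK⟩ := splitHarmonicMassConfined_of_taoTeravainen hTT ht0 ht1
  obtain ⟨Kp, hKpdef⟩ : ∃ Kp : ℝ, Kp = max K 0 := ⟨_, rfl⟩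
  have hKp0 : 0 ≤ Kp := by rw [hKpdef]; exact le_max_right _ _
  have hK' : SplitHarmonicMassConfined t 1 Kp := hK.mono (by rw [hKpdef]; exact le_max_left _ _)
  obtain ⟨a, hadef⟩ : ∃ a : ℝ, a = t / (1 + 4 * t) := ⟨_, rfl⟩
  have ha0 : 0 < a := by rw [hadef]; positivity
  -- threshold on ℓ = log D
  obtain ⟨B, hBdef⟩ : ∃ B : ℝ, B = 3 * Kp / ε + 1 := ⟨_, rfl⟩
  have hB1 : 1 ≤ B := by
    rw [hBdef]; linarith [show (0 : ℝ) ≤ 3 * Kp / ε by positivity]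
  obtain ⟨L₀, hL₀def⟩ : ∃ L₀ : ℝ, L₀ = max 1 (max (6 / ε) (B ^ a⁻¹)) := ⟨_, rfl⟩
  refine ⟨⌈Real.exp L₀⌉₊, ?_⟩
  intro D _ χ hD₀ hχ hprim hquad hA
  have hDge : Real.exp L₀ ≤ (D : ℝ) := Nat.ceil_le.mp hD₀
  have hD0 : (0 : ℝ) < D := lt_of_lt_of_le (Real.exp_pos _) hDge
  obtain ⟨ℓ, hℓdef⟩ : ∃ ℓ : ℝ, ℓ = Real.log (D : ℝ) := ⟨_, rfl⟩
  have hℓL : L₀ ≤ ℓ := by rw [hℓdef, Real.le_log_iff_exp_le hD0]; exact hDge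
  have hℓ1 : 1 ≤ ℓ := le_trans (by rw [hL₀def]; exact le_max_left _ _) hℓL
  have hℓpos : 0 < ℓ := by linarith
  have hℓ6 : 6 / ε ≤ ℓ := le_trans (by rw [hL₀def]; exact (le_max_left _ _).trans (le_max_right _ _)) hℓL
  have hℓB : B ^ a⁻¹ ≤ ℓ := le_trans (by rw [hL₀def]; exact (le_max_right _ _).trans (le_max_right _ _)) hℓL
  rw [← hℓdef]
  -- the (R1) bound on [D^t, D]
  have hR1 := hK' D χ hχ hprim hquad hA
  rw [← hℓdef, ← hadef, Real.rpow_one, Nat.floor_natCast] at hR1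
  -- split the sum at ⌈D^t⌉
  have hL₀1 : 1 ≤ L₀ := by rw [hL₀def]; exact le_max_left _ _
  have hD1 : (1 : ℝ) ≤ D := by linarith [Real.add_one_le_exp L₀]
  have hDt1 : 1 ≤ (D : ℝ) ^ t := Real.one_le_rpow hD1 ht0.le
  rw [← Finset.sum_filter_add_sum_filter_not _ (fun p : ℕ => p < ⌈(D : ℝ) ^ t⌉₊)]
  -- low part: Mertens
  have hlow := sum_log_div_lt_ceil_le χ hDt1
  rw [Real.log_rpow hD0, ← hℓdef] at hlow
  -- high part: ≤ ℓ · Σ 1/p ≤ ℓ · Kp ℓ^{-a}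
  have hhigh : (∑ p ∈ ((Finset.Icc 1 D).filter (fun p : ℕ => p.Prime ∧ χ ((p : ℕ) : ZMod D) = 1)).filter
      (fun p : ℕ => ¬ p < ⌈(D : ℝ) ^ t⌉₊), Real.log (p : ℝ) / (p : ℝ)) ≤ ℓ * (Kp * ℓ ^ (-a)) := by
    calc (∑ p ∈ ((Finset.Icc 1 D).filter (fun p : ℕ => p.Prime ∧ χ ((p : ℕ) : ZMod D) = 1)).filter
          (fun p : ℕ => ¬ p < ⌈(D : ℝ) ^ t⌉₊), Real.log (p : ℝ) / (p : ℝ))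
        ≤ ∑ p ∈ ((Finset.Icc 1 D).filter (fun p : ℕ => p.Prime ∧ χ ((p : ℕ) : ZMod D) = 1)).filter
          (fun p : ℕ => ¬ p < ⌈(D : ℝ) ^ t⌉₊), ℓ * (1 / (p : ℝ)) := by
          apply Finset.sum_le_sum
          intro p hp
          simp only [Finset.mem_filter, Finset.mem_Icc] at hp
          obtain ⟨⟨⟨hp1, hpD⟩, _, _⟩, _⟩ := hp
          have hp1r : (1 : ℝ) ≤ p := by exact_mod_cast hp1
          have hpDr : (p : ℝ) ≤ D := by exact_mod_cast hpD
          have hlogp : Real.log p ≤ ℓ := by rw [hℓdef]; exact Real.log_le_log (by linarith) hpDr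
          rw [mul_one_div]
          exact div_le_div_of_nonneg_right hlogp (by linarith)
      _ = ℓ * ∑ p ∈ ((Finset.Icc 1 D).filter (fun p : ℕ => p.Prime ∧ χ ((p : ℕ) : ZMod D) = 1)).filter
          (fun p : ℕ => ¬ p < ⌈(D : ℝ) ^ t⌉₊), 1 / (p : ℝ) := by rw [Finset.mul_sum]
      _ ≤ ℓ * ∑ p ∈ (Finset.Icc ⌈(D : ℝ) ^ t⌉₊ D).filter
          (fun p : ℕ => p.Prime ∧ χ ((p : ℕ) : ZMod D) = 1), 1 / (p : ℝ) := by
          apply mul_le_mul_of_nonneg_left _ hℓpos.le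
          apply Finset.sum_le_sum_of_subset_of_nonneg
          · intro p hp
            simp only [Finset.mem_filter, Finset.mem_Icc, not_lt] at hp ⊢
            exact ⟨⟨hp.2, hp.1.1.2⟩, hp.1.2⟩
          · intro p _ _
            positivity
      _ ≤ ℓ * (Kp * ℓ ^ (-a)) := mul_le_mul_of_nonneg_left hR1 hℓpos.le
  -- numeric: t ℓ + 2 + ℓ Kp ℓ^{-a} ≤ ε ℓ
  have h2 : 2 ≤ ε / 3 * ℓ := by
    rw [div_le_iff₀ hε] at hℓ6
    have : ε / 3 * ℓ = ℓ * ε / 3 := by ring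
    rw [this, le_div_iff₀ (by norm_num)]
    linarith
  have hKa : Kp * ℓ ^ (-a) ≤ ε / 3 := by
    -- ℓ^a ≥ B = 3Kp/ε + 1
    have hℓa : B ≤ ℓ ^ a := by
      have h := Real.rpow_le_rpow (by positivity) hℓB ha0.le
      rwa [Real.rpow_inv_rpow (by linarith) ha0.ne'] at h
    have hℓapos : 0 < ℓ ^ a := Real.rpow_pos_of_pos hℓpos _
    rw [Real.rpow_neg hℓpos.le, ← div_eq_mul_inv, div_le_iff₀ hℓapos]
    rw [hBdef] at hℓa
    have : Kp ≤ ε / 3 * (3 * Kp / ε + 1) := by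
      have e : ε / 3 * (3 * Kp / ε + 1) = Kp + ε / 3 := by field_simp
      rw [e]; linarith
    exact this.trans (mul_le_mul_of_nonneg_left hℓa (by positivity))
  have htℓ : t * ℓ ≤ ε / 3 * ℓ := mul_le_mul_of_nonneg_right htε hℓpos.le
  have hKℓ : ℓ * (Kp * ℓ ^ (-a)) ≤ ℓ * (ε / 3) := mul_le_mul_of_nonneg_left hKa hℓpos.le
  linarith

end Summit.Parity.GeneralizedHardyLittlewood.Theorems.PrimeLevelFamEdgeIdeaDeltas
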